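import Mathlib
import Literature.NumberTheory.LFunctions.FeketePolynomial
import Literature.RingTheory.Valuation.AlgClosedResidue
import Literature.RingTheory.Valuation.RootReduction
import Summits.ValiantsHypothesis.ValiantsHypothesis.Theses.FeketeSOS

/-!
# `FeketeSOS.DepthZeroShadow` (stmt-ValiantsHypothesis-14992) — the depth-0 case of `SublinearShadow`

A complex weighted sum-of-squares representation `Σ_{i<s} c_i g_i² = F_p` of the Fekete polynomial has
GOOD REDUCTION at a place `O` of `ℂ` above `p` (a valuation subring `O ⊂ ℂ` with `p ∈ 𝔪_O`) when every
coefficient of every TERM `c_i g_i²` lies in `O`.  Then the representation has a characteristic-`p`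
shadow with the same number of squares and no more monomials:

1. **per-term Gauss normalisation** (`dzs_term_model`): for `g_i ≠ 0` pick a coefficient `a_i` of `g_i`
   of maximal valuation (`exists_valuation_coeff_eq_gaussVal`); `h_i = g_i / a_i` has Gauss value `1`, so
   it lifts to `H_i ∈ O[X]` (same support) with a coefficient equal to `1`, whence `H̄_i ≠ 0` and
   `gaussVal (h_i²) = 1` (`gaussVal_map_eq_one`); as `c_i g_i² = (c_i a_i²) · h_i²` has Gauss value `≤ 1`,
   `d_i = c_i a_i² ∈ O` (`gaussVal_C_mul`) and `c_i g_i² = d_i H_i²` coefficientwise;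
2. the identity `Σ d_i H_i² = F_p` holds in `O[X]` (`O[X] → ℂ[X]` is injective) and is pushed to the
   residue field `K = O/𝔪_O`, of characteristic `p` (`charP_residueField`);
3. **cyclic fold**: each `H̄_i` is congruent modulo `X^p - 1` to its fold `Σ_n H̄_{i,n} X^{n mod p}` of
   degree `< p` with no more monomials (the `dzs_*fold*` lemmas below; they mirror the `grt_*` lemmas of
   `Theorems/FeketeSOSFeketeSOSHardGoodReductionTransfer.lean`, restated here to keep this file's import
   closure inside `Literature` + the route file).

The one-product version is `FeketeNoSparseSplitCyclic.stub_primitiveReduction`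
(`Theorems/FeketeSOSFeketeNoSparseSplitPrimitiveReduction.lean`).
-/

namespace Summit.ValiantsHypothesis.ValiantsHypothesis.Theorems

open Polynomial IsLocalRing
open Literature.NumberTheory.LFunctions
open Literature.RingTheory.Valuation

-- `Summit.ValiantsHypothesis.ValiantsHypothesis.…` is the tree's mandated single-conjunct layout (Sub = Summit).
set_option linter.dupNamespace false

section Fold

variable {k : Type*} [CommRing k]

/-- The cyclic fold `Σ_{n ∈ supp f} f_n X^{n mod p}` has no more monomials than `f`: its support lies
in the image of `supp f` under `n ↦ n mod p`. -/
theorem dzs_card_support_fold_le (f : k[X]) (p : ℕ) :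
    (∑ n ∈ f.support, C (f.coeff n) * X ^ (n % p)).support.card ≤ f.support.card := by
  classical
  calc (∑ n ∈ f.support, C (f.coeff n) * X ^ (n % p)).support.card
      ≤ (f.support.image fun n => n % p).card := by
        refine Finset.card_le_card fun m hm => ?_
        rw [mem_support_iff, finsetSum_coeff] at hm
        obtain ⟨n, hn, hne⟩ := Finset.exists_ne_zero_of_sum_ne_zero hm
        rw [coeff_C_mul, coeff_X_pow] at hne
        refine Finset.mem_image.mpr ⟨n, hn, ?_⟩
        by_contra h
        exact hne (by rw [if_neg (Ne.symm h), mul_zero])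
    _ ≤ f.support.card := Finset.card_image_le

/-- The cyclic fold has degree `< p` (for `0 < p`). -/
theorem dzs_natDegree_fold_lt (f : k[X]) {p : ℕ} (hp : 0 < p) :
    (∑ n ∈ f.support, C (f.coeff n) * X ^ (n % p)).natDegree < p := by
  refine lt_of_le_of_lt (natDegree_sum_le_of_forall_le (n := p - 1) f.support _ fun n _ => ?_)
    (Nat.sub_lt hp one_pos)
  refine (natDegree_C_mul_X_pow_le (f.coeff n) (n % p)).trans ?_
  have := Nat.mod_lt n hp
  omega

/-- `X^p - 1 ∣ X^{n mod p} - X^n`. -/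
theorem dzs_X_pow_sub_one_dvd_X_pow_mod_sub (p n : ℕ) :
    (X : k[X]) ^ p - 1 ∣ X ^ (n % p) - X ^ n := by
  have h : (X : k[X]) ^ n = X ^ (n % p) * (X ^ p) ^ (n / p) := by
    rw [← pow_mul, ← pow_add, Nat.mod_add_div]
  have h2 : (X : k[X]) ^ (n % p) - X ^ n = - (X ^ (n % p) * ((X ^ p) ^ (n / p) - 1 ^ (n / p))) := by
    rw [h]; ring
  rw [h2, dvd_neg]
  exact Dvd.dvd.mul_left (sub_dvd_pow_sub_pow ((X : k[X]) ^ p) 1 (n / p)) _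

/-- The cyclic fold of `f` is congruent to `f` modulo `X^p - 1`. -/
theorem dzs_X_pow_sub_one_dvd_fold_sub (f : k[X]) (p : ℕ) :
    (X : k[X]) ^ p - 1 ∣ (∑ n ∈ f.support, C (f.coeff n) * X ^ (n % p)) - f := by
  have h : (∑ n ∈ f.support, C (f.coeff n) * X ^ (n % p)) - f
      = ∑ n ∈ f.support, C (f.coeff n) * (X ^ (n % p) - X ^ n) := by
    simp only [mul_sub, Finset.sum_sub_distrib, ← as_sum_support_C_mul_X_pow]
  rw [h]
  exact Finset.dvd_sum fun n _ => Dvd.dvd.mul_left (dzs_X_pow_sub_one_dvd_X_pow_mod_sub p n) _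

/-- The support of `C a * f` lies in the support of `f`. -/
theorem dzs_support_C_mul_subset (a : k) (f : k[X]) : (C a * f).support ⊆ f.support := fun n hn => by
  rw [mem_support_iff] at hn ⊢
  rw [coeff_C_mul] at hn
  exact right_ne_zero_of_mul hn

/-- **Assembly modulo `X^p - 1`**: if `Σ_i a_i h_i² = F` and `B_j ≡ h_j (mod X^p - 1)`, then
`Σ_j a_j B_j² ≡ F (mod X^p - 1)`. -/
theorem dzs_dvd_sum_sq_sub {p s : ℕ} (a : Fin s → k) (h B : Fin s → k[X]) (F : k[X])
    (hrep : ∑ i, C (a i) * h i ^ 2 = F) (hB : ∀ j, (X : k[X]) ^ p - 1 ∣ B j - h j) :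
    (X : k[X]) ^ p - 1 ∣ (∑ j, C (a j) * B j ^ 2) - F := by
  rw [← hrep, ← Finset.sum_sub_distrib]
  refine Finset.dvd_sum fun j _ => ?_
  have e : C (a j) * B j ^ 2 - C (a j) * h j ^ 2 = C (a j) * (B j + h j) * (B j - h j) := by ring
  rw [e]
  exact Dvd.dvd.mul_left (hB j) _

end Fold

/-- A complex polynomial all of whose coefficients lie in a valuation subring `O ⊂ ℂ` is the image of
a polynomial over `O` with the same support. -/
theorem dzs_exists_lift (O : ValuationSubring ℂ) {h : ℂ[X]} (hh : ∀ n, h.coeff n ∈ O) :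
    ∃ H : O[X], H.map (algebraMap O ℂ) = h ∧ H.support = h.support := by
  have hl : h ∈ Polynomial.lifts (algebraMap O ℂ) := by
    rw [lifts_iff_coeff_lifts]
    intro n
    exact ⟨⟨h.coeff n, hh n⟩, rfl⟩
  obtain ⟨H, hH⟩ := (mem_lifts h).mp hl
  refine ⟨H, hH, ?_⟩
  rw [← hH]
  exact (support_map_of_injective H (IsFractionRing.injective O ℂ)).symm

/-- **Per-term Gauss normalisation.**  If every coefficient of `c · g²` lies in the valuation subring
`O ⊂ ℂ`, then `c · g² = d · H²` (coefficientwise) for some `d ∈ O` and some `H ∈ O[X]` with no more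
monomials than `g`.  (For `g ≠ 0`: `H = g / a` for a coefficient `a` of `g` of maximal valuation and
`d = c a²`; the Gauss value of `H²` is `1` because `H` has a coefficient `1`, so `H̄² ≠ 0`.) -/
theorem dzs_term_model (O : ValuationSubring ℂ) (c : ℂ) (g : ℂ[X])
    (hT : ∀ n, (C c * g ^ 2).coeff n ∈ O) :
    ∃ (d : O) (H : O[X]), (C d * H ^ 2).map (algebraMap O ℂ) = C c * g ^ 2 ∧
      H.support.card ≤ g.support.card := by
  classical
  set ι : O →+* ℂ := algebraMap O ℂ with hι
  have hιinj : Function.Injective ι := IsFractionRing.injective O ℂ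
  by_cases hg : g = 0
  · refine ⟨0, 0, ?_, ?_⟩
    · simp [hg]
    · simp
  -- a coefficient of maximal valuation
  obtain ⟨i, hi⟩ := exists_valuation_coeff_eq_gaussVal O hg
  set a : ℂ := g.coeff i with ha
  have hva : O.valuation a ≠ 0 := by
    rw [hi]; exact gaussVal_ne_zero O hg
  have ha0 : a ≠ 0 := (Valuation.ne_zero_iff _).mp hva
  -- the normalised polynomial `h = a⁻¹ g` has Gauss value `1`, hence coefficients in `O`
  set h : ℂ[X] := C a⁻¹ * g with hh
  have hgauss : gaussVal O h = 1 := by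
    rw [hh, gaussVal_C_mul, map_inv₀, ← hi, inv_mul_cancel₀ hva]
  have hcoef : ∀ n, h.coeff n ∈ O := fun n => by
    rw [← O.valuation_le_one_iff]
    calc O.valuation (h.coeff n) ≤ gaussVal O h := valuation_coeff_le_gaussVal O h n
      _ = 1 := hgauss
  obtain ⟨H, hH, hHsupp⟩ := dzs_exists_lift O hcoef
  -- the `i`-th coefficient of `H` is `1`, so the reduction of `H²` is non-zero
  have hHi : H.coeff i = 1 := by
    apply hιinj
    rw [← coeff_map, hH, hh, coeff_C_mul, ← ha, inv_mul_cancel₀ ha0, map_one]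
  have hHred : (H ^ 2).map (residue O) ≠ 0 := by
    rw [Polynomial.map_pow]
    refine pow_ne_zero 2 fun h0 => ?_
    have h1 := congrArg (fun P => P.coeff i) h0
    simp only [coeff_map, hHi, map_one, coeff_zero] at h1
    exact one_ne_zero h1
  have hgauss2 : gaussVal O (h ^ 2) = 1 := by
    have h2 : h ^ 2 = (H ^ 2).map ι := by
      rw [Polynomial.map_pow, hH]
    rw [h2]
    exact gaussVal_map_eq_one O hHred
  -- `c g² = (c a²) h²`, so `v(c a²) = gaussVal (c g²) ≤ 1`
  have hT' : C c * g ^ 2 = C (c * a ^ 2) * h ^ 2 := by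
    rw [hh, mul_pow, ← C_pow, ← mul_assoc, ← C_mul, inv_pow, mul_inv_cancel_right₀ (pow_ne_zero 2 ha0)]
  have hd : c * a ^ 2 ∈ O := by
    rw [← O.valuation_le_one_iff]
    have h1 : gaussVal O (C c * g ^ 2) ≤ 1 :=
      gaussVal_le O fun n => (O.valuation_le_one_iff _).mpr (hT n)
    rw [hT', gaussVal_C_mul, hgauss2, mul_one] at h1
    exact h1
  refine ⟨⟨c * a ^ 2, hd⟩, H, ?_, ?_⟩
  · rw [Polynomial.map_mul, map_C, Polynomial.map_pow, hH, hT']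
    rfl
  · rw [hHsupp, hh]
    exact Finset.card_le_card (dzs_support_C_mul_subset _ _)

/-- **`DepthZeroShadow` (stmt-ValiantsHypothesis-14992).**  If `Σ_{i<s} c_i g_i² = F_p` over `ℂ` and some
valuation subring `O ⊂ ℂ` with `p ∈ 𝔪_O` contains every coefficient of every term `c_i g_i²`, then over
the residue field `K` of `O` (characteristic `p`) there are `c' : Fin s → K` and `g'_j ∈ K[X]` of degree
`< p` with `|supp g'_j| ≤ |supp g_j|` and `X^p - 1 ∣ Σ_j c'_j g'_j² - F̄_p`. -/
theorem depthZeroShadow_proof :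
    Summit.ValiantsHypothesis.ValiantsHypothesis.Theses.FeketeSOS.DepthZeroShadow := by
  unfold Summit.ValiantsHypothesis.ValiantsHypothesis.Theses.FeketeSOS.DepthZeroShadow
  intro p _ s c g hrep hO
  obtain ⟨O, hpO, hcoef⟩ := hO
  classical
  have hprime : p.Prime := Fact.out
  have hp0 : 0 < p := hprime.pos
  haveI hchar : CharP (ResidueField O) p := charP_residueField O hpO
  set ι : O →+* ℂ := algebraMap O ℂ with hι
  have hιinj : Function.Injective ι := IsFractionRing.injective O ℂ
  set ρ : O →+* ResidueField O := residue O with hρ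
  -- per-term models over `O`
  choose d H hdH hHsupp using fun i => dzs_term_model O (c i) (g i) (hcoef i)
  -- the Fekete polynomial pushed along `ℤ → R → S` is the Fekete polynomial pushed along `ℤ → S`
  have hFmap : ∀ (R S : Type) [CommRing R] [CommRing S] (f : R →+* S),
      ((feketePolynomial p).map (Int.castRingHom R)).map f
        = (feketePolynomial p).map (Int.castRingHom S) := fun R S _ _ f => by
    rw [Polynomial.map_map, RingHom.ext_int (f.comp (Int.castRingHom R)) (Int.castRingHom S)]
  have hFK : (feketePolynomial p).map (Int.castRingHom (ResidueField O)) =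
      ∑ m ∈ Finset.range p, C ((legendreSym p m : ℤ) : ResidueField O) * X ^ m := by
    simp only [map_feketePolynomial, eq_intCast]
  -- (1) the identity in `O[X]`
  have hrepO : (∑ i, C (d i) * H i ^ 2) = (feketePolynomial p).map (Int.castRingHom O) := by
    apply Polynomial.map_injective ι hιinj
    rw [hFmap O ℂ ι, map_feketePolynomial_complex, ← hrep, Polynomial.map_sum]
    exact Finset.sum_congr rfl fun i _ => hdH i
  -- (2) pushed to the residue field
  obtain ⟨c', hc'⟩ : ∃ c' : Fin s → ResidueField O, ∀ i, c' i = ρ (d i) := ⟨_, fun _ => rfl⟩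
  obtain ⟨hK, hhK⟩ : ∃ hK : Fin s → (ResidueField O)[X], ∀ i, hK i = (H i).map ρ := ⟨_, fun _ => rfl⟩
  have hrepK : (∑ i, C (c' i) * hK i ^ 2) =
      (feketePolynomial p).map (Int.castRingHom (ResidueField O)) := by
    rw [← hFmap O (ResidueField O) ρ, ← hrepO, Polynomial.map_sum]
    refine Finset.sum_congr rfl fun i _ => ?_
    rw [Polynomial.map_mul, Polynomial.map_pow, map_C, hc' i, hhK i]
  have hhKsupp : ∀ i, (hK i).support.card ≤ (g i).support.card := fun i => by
    rw [hhK i]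
    exact (Finset.card_le_card (support_map_subset _ _)).trans (hHsupp i)
  -- (3) fold cyclically and assemble
  obtain ⟨g', hg'⟩ : ∃ g' : Fin s → (ResidueField O)[X],
      ∀ j, g' j = ∑ n ∈ (hK j).support, C ((hK j).coeff n) * X ^ (n % p) := ⟨_, fun _ => rfl⟩
  have hg'deg : ∀ j, (g' j).natDegree < p := fun j => by
    rw [hg' j]; exact dzs_natDegree_fold_lt (hK j) hp0
  have hg'supp : ∀ j, (g' j).support.card ≤ (g j).support.card := fun j => by
    rw [hg' j]; exact (dzs_card_support_fold_le (hK j) p).trans (hhKsupp j)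
  have hg'dvd : ∀ j, (X : (ResidueField O)[X]) ^ p - 1 ∣ g' j - hK j := fun j => by
    rw [hg' j]; exact dzs_X_pow_sub_one_dvd_fold_sub (hK j) p
  have hfin : (X : (ResidueField O)[X]) ^ p - 1 ∣
      (∑ j, C (c' j) * g' j ^ 2) - ∑ m ∈ Finset.range p, C ((legendreSym p m : ℤ) : ResidueField O) * X ^ m := by
    have h := dzs_dvd_sum_sq_sub c' hK g' _ hrepK hg'dvd
    rw [hFK] at h
    exact h
  exact ⟨ResidueField O, inferInstance, hchar, c', g', hg'deg, hg'supp, hfin⟩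

end Summit.ValiantsHypothesis.ValiantsHypothesis.Theorems
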